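import Literature.Geometry.Riemannian.GurskyViaclovskyClosednessChartEquation
import Literature.Analysis.Calculus.CoordinateJets
import HarnessLib

/-!
# Gursky–Viaclovsky closedness: the Evans–Krylov (concave) form of the chart equation as a jet
# function — the definition

Support file for the named fact
`Literature.Geometry.Riemannian.gurskyViaclovsky_pathClosed_weighted_four` (Gursky–Viaclovsky
2003, Prop. 6: the interior `C^{2,α}` estimate behind the closedness of the weighted `σ₂` path is
Evans–Krylov's, Gilbarg–Trudinger Thm. 17.14, which needs the operator to be CONCAVE in the
second derivatives). The chart form of the background equation
(`GurskyViaclovskyClosednessChartEquation.lean`) is `chartOperator G t (W y) y (DU) (D²U) = Q e^{4U}`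
with `chartOperator G t W' y p r = 4Σ^t(y,p,r) − ¼W'`, `Σ^t = ½((tr_G 𝒜^t)² − |𝒜^t|²_G) = σ₂(G⁻¹𝒜^t)`
— and `σ₂` is not concave, but `σ₂^{1/2}` is concave on the admissible cone `Γ₂⁺`
(Gursky–Viaclovsky Prop. 1 (iii)). This file only DEFINES the concave reformulation as a function
of the coordinate `2`-jet (`Literature/Analysis/Calculus/CoordinateJets.lean`), in the standard
basis of `ℝ⁴`:

* `ekOperator G W Q ψ (y, t, J) = ψ(Σ^t(y, pOf J, rOf J)) − ψ(¼(Q(y) e^{4J₀} + ¼W(y)))`, with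
  `Σ^t(y,p,r) = ¼·chartOperator G t 0 y p r` and `ψ : ℝ → ℝ` a parameter (in the application a
  smooth function equal to `√` on `[c/2, ∞)`, `c > 0` the admissibility margin of the solutions,
  so that `ekOperator` is globally smooth and equals `σ₂^{1/2}(A^t_U) − (¼(Qe^{4U} + ¼|W|²))^{1/2}`
  at and near the jets of the solutions);
* `ekOperator_apply` — unfolding lemma.

Its calculus (smoothness, vanishing along solutions, top-slot derivatives, the two concavity
inequalities of Gilbarg–Trudinger's proof) is in `GurskyViaclovskyClosednessEKOperator.lean`.

## References

* M. J. Gursky, J. A. Viaclovsky, J. Differential Geom. 63 (2003) 131–154, §2 Prop. 1 (iii),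
  Prop. 6. [GurskyViaclovsky2003]
* D. Gilbarg, N. S. Trudinger, *Elliptic Partial Differential Equations of Second Order* (2001),
  §17.4, Thm. 17.14 (hypothesis (ii)'). [GilbargTrudinger2001]
-/

noncomputable section

namespace Literature.Geometry.Riemannian.GurskyViaclovskyPath

open Literature.Analysis.Calculus

/-- **The Evans–Krylov form of the chart equation** as a function of `(y, t, J)`,
`J ∈ CJet (Fin 4) 2` a coordinate `2`-jet in the standard basis:
`ψ(¼·chartOperator G t 0 y (pOf J) (rOf J)) − ψ(¼(Q(y) e^{4J₀} + ¼W(y)))`. Along the solutions of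
`chartOperator G t (W y) y (DU) (D²U) = Q e^{4U}` both arguments of `ψ` coincide, so the function
vanishes at their jets for every `ψ`. [cite: GurskyViaclovsky2003, §2 Prop. 1 (iii) and Prop. 6] -/
def ekOperator
    (G : EuclideanSpace ℝ (Fin 4) →
      EuclideanSpace ℝ (Fin 4) →L[ℝ] EuclideanSpace ℝ (Fin 4) →L[ℝ] ℝ)
    (W Q : EuclideanSpace ℝ (Fin 4) → ℝ) (ψ : ℝ → ℝ) :
    EuclideanSpace ℝ (Fin 4) × ℝ × CJet (Fin 4) 2 → ℝ := fun x ↦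
  ψ (chartOperator G x.2.1 0 x.1 (pOf (EuclideanSpace.basisFun (Fin 4) ℝ) x.2.2)
      (rOf (EuclideanSpace.basisFun (Fin 4) ℝ) x.2.2) / 4) -
    ψ ((Q x.1 * Real.exp (4 * x.2.2 0 Fin.elim0) + W x.1 / 4) / 4)

/-- Unfolding lemma. [folklore] -/
theorem ekOperator_apply
    (G : EuclideanSpace ℝ (Fin 4) →
      EuclideanSpace ℝ (Fin 4) →L[ℝ] EuclideanSpace ℝ (Fin 4) →L[ℝ] ℝ)
    (W Q : EuclideanSpace ℝ (Fin 4) → ℝ) (ψ : ℝ → ℝ) (y : EuclideanSpace ℝ (Fin 4)) (t : ℝ)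
    (J : CJet (Fin 4) 2) :
    ekOperator G W Q ψ (y, t, J) =
      ψ (chartOperator G t 0 y (pOf (EuclideanSpace.basisFun (Fin 4) ℝ) J)
          (rOf (EuclideanSpace.basisFun (Fin 4) ℝ) J) / 4) -
        ψ ((Q y * Real.exp (4 * J 0 Fin.elim0) + W y / 4) / 4) :=
  rfl

/-- The Evans–Krylov jet function does not see the parameter `W'` of `chartOperator`:
`chartOperator G t W' y p r = 4 · (¼ chartOperator G t 0 y p r) − ¼ W'`. [folklore] -/
theorem chartOperator_eq_zero_sub
    (G : EuclideanSpace ℝ (Fin 4) →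
      EuclideanSpace ℝ (Fin 4) →L[ℝ] EuclideanSpace ℝ (Fin 4) →L[ℝ] ℝ)
    (t W' : ℝ) (y : EuclideanSpace ℝ (Fin 4)) (p : EuclideanSpace ℝ (Fin 4) →L[ℝ] ℝ)
    (r : EuclideanSpace ℝ (Fin 4) →L[ℝ] EuclideanSpace ℝ (Fin 4) →L[ℝ] ℝ) :
    chartOperator G t W' y p r = chartOperator G t 0 y p r - 1 / 4 * W' := by
  simp only [chartOperator]
  ring

end Literature.Geometry.Riemannian.GurskyViaclovskyPath

end
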